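import Summits.FinalStateConjecture.FinalStateConjecture.Theorems.ZeroEnergyKerrOrBombErgoregionBombModTEscapeEngineFree

/-!
# `ErgoregionBombModT` — certificate: ZF₀ gives the non-trapping hypothesis of `NonTrappingHawkingRigidity` on every telescope hole
# (crux stmt-FinalStateConjecture-17838, line `SketchIdeator4` v5; lead c7)

Route `ZeroEnergyKerrOrBomb` of the Final State Conjecture.  The route's dichotomy variable is the zero-energy trapped set modulo the
stationary flow: the rigidity crux `NonTrappingHawkingRigidity` (stmt-FinalStateConjecture-13896) assumes, as its hypothesis h16, that on
the telescope hole at hand NO maximal null geodesic with `γ̇ ≠ 0`, `g(γ̇, T) = 0` is confined to the cage `⋃ₜ φₜ(S)` of a compact `S` of the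
d.o.c.; the bomb crux `ErgoregionBombModT` (stmt-17838) assumes the negation.  Line `SketchIdeator4` reduced the bomb crux to the open stub
ZF₀ (`stub_zeroEnergyNullConvexFunction`: a flow-invariant `C²` function strictly convex along the non-zero zero-energy null directions over
`S`, on a neighbourhood of every cage) through the X-free escape engine `stub_escapeEngineFree` (p163760).  This file records the other face
of the same reduction, for the planner: **ZF₀ alone yields h16 of `NonTrappingHawkingRigidity` for EVERY telescope hole** — unconditionally
(no Chruściel–Costa time function; compare the skeptical-reader note of 2026-08-17T11:11Z, which obtained this from the v2 kernel, i.e.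
modulo the spacelike Killing time).  So under ZF₀ both the bomb branch and the Killing-mode-stability hypothesis of the target
`KerrOrBombModT` are idle: the route's content is `ZF₀ ∧ NonTrappingHawkingRigidity ∧ HawkingExtensionIsKerr`.

The statement carries the instance binder `[Kerr.Facts]` because ZF₀, like the bomb crux, is quantified under it (the binder is
otherwise unused); the conclusion is the telescope of `NonTrappingHawkingRigidity` followed by its hypothesis h16, verbatim.
-/

noncomputable section

open Bundle Set Filter Function
open scoped Manifold Topology

set_option linter.dupNamespace false

namespace Summit.FinalStateConjecture.FinalStateConjecture.Theorems.ErgoregionBombModT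

open Literature.Geometry.Lorentzian

/-- **Certificate: ZF₀ ⇒ the non-trapping hypothesis h16 of `NonTrappingHawkingRigidity` on every telescope hole** (registered
certificate `nonTrapping_of_nullConvexFunction` of crux stmt-FinalStateConjecture-17838, line `SketchIdeator4` v5).  Given the Kerr
chart facts as an ambient instance (the binder under which ZF₀ is quantified) and ZF₀ (hypothesis, the registered open stub verbatim), every
vacuum `I⁺`-regular future-presented telescope hole satisfies: for every compact `S ⊆ ⟨⟨M_ext⟩⟩`, every maximal null geodesic with
`γ̇ ≠ 0`, `g(γ̇, T) = 0` on its non-empty domain leaves the cage `⋃ₜ φₜ(S)`.  Proof: by contradiction from the X-free engine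
`stub_escapeEngineFree` (p163760) applied to the `(W, F)` of ZF₀ on that cage. -/
theorem nonTrapping_of_nullConvexFunction :
    ∀ [Literature.Geometry.Lorentzian.Kerr.Facts], (∀ (𝓑 : Literature.Geometry.Lorentzian.StationaryAFBlackHole.{0}) [𝓑.metric.HasLeviCivita] [Literature.Geometry.Lorentzian.Kerr.Facts], 𝓑.metric.toPseudoRiemannianMetric.IsRicciFlat → 𝓑.IsIPlusRegular → (∀ p : 𝓑.carrier, p ∈ 𝓑.metric.chronologicalFuture 𝓑.timeOrientation 𝓑.Mext) → (∀ p ∈ 𝓑.doc, 𝓑.killing p ≠ 0) → SimplyConnectedSpace 𝓑.doc → ∀ (U : Set 𝓑.carrier) (K : Π x : 𝓑.carrier, TangentSpace (𝓡 4) x), IsOpen U → 𝓑.horizon ⊆ U → IsConnected 𝓑.horizon → ContMDiffOn (𝓡 4) ((𝓡 4).prod 𝓘(ℝ, Literature.Geometry.Lorentzian.E4)) ((⊤ : ℕ∞) : WithTop ℕ∞) (fun x ↦ (Bundle.TotalSpace.mk' Literature.Geometry.Lorentzian.E4 x (K x) : TangentBundle (𝓡 4) 𝓑.carrier)) U → (∀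 x ∈ U, ∀ v w : TangentSpace (𝓡 4) x, 𝓑.metric.val x (𝓑.metric.leviCivita K x v) w + 𝓑.metric.val x v (𝓑.metric.leviCivita K x w) = 0) → (∀ x ∈ U, VectorField.mlieBracket (𝓡 4) 𝓑.killing K x = 0) → (∀ p ∈ 𝓑.horizon, K p ≠ 0) → (∀ γ : ℝ → 𝓑.carrier, IsMIntegralCurve γ K → γ 0 ∈ 𝓑.horizon → ∀ t, γ t ∈ 𝓑.horizon) → (∀ x ∈ U ∩ 𝓑.doc, 𝓑.metric.val x (K x) (K x) < 0) → (∃ S₀ : Set 𝓑.carrier, IsCompact S₀ ∧ S₀ ⊆ 𝓑.doc ∧ ∀ y ∈ 𝓑.doc, 0 ≤ 𝓑.metric.val y (𝓑.killing y) (𝓑.killing y) → y ∉ U → y ∈ Literature.Geometry.Lorentzian.stationaryOrbit 𝓑.killing S₀) → ∀ S : Set 𝓑.carrier, IsCompact S → S ⊆ 𝓑.doc → ∃ (W : Set 𝓑.carrier) (F : 𝓑.carrier → ℝ), IsOpen W ∧ Literature.Geometry.Lorentzian.stationaryOrbit 𝓑.killing S ⊆ W ∧ ContMDiffOn (𝓡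 4) 𝓘(ℝ, ℝ) 2 F W ∧ (∀ σ : ℝ → 𝓑.carrier, IsMIntegralCurve σ 𝓑.killing → σ 0 ∈ W → ∀ t, F (σ t) = F (σ 0)) ∧ ∀ x ∈ S, ∀ k : TangentSpace (𝓡 4) x, 𝓑.metric.val x k k = 0 → 𝓑.metric.val x k (𝓑.killing x) = 0 → k ≠ 0 → 0 < 𝓑.metric.toPseudoRiemannianMetric.hessian F x k k) → ∀ (𝓑 : Literature.Geometry.Lorentzian.StationaryAFBlackHole.{0}) [𝓑.metric.HasLeviCivita], 𝓑.metric.toPseudoRiemannianMetric.IsRicciFlat → 𝓑.IsIPlusRegular → (∀ p : 𝓑.carrier, p ∈ 𝓑.metric.chronologicalFuture 𝓑.timeOrientation 𝓑.Mext) → (∀ p ∈ 𝓑.doc, 𝓑.killing p ≠ 0) → SimplyConnectedSpace 𝓑.doc → ∀ (U : Set 𝓑.carrier) (K : Π x : 𝓑.carrier, TangentSpace (𝓡 4) x), IsOpen U → 𝓑.horizon ⊆ U → IsConnected 𝓑.horizon → ContMDiffOn (𝓡 4) ((𝓡 4).prod 𝓘(ℝ, Literature.Geometry.Lorentzian.E4))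 ((⊤ : ℕ∞) : WithTop ℕ∞) (fun x ↦ (Bundle.TotalSpace.mk' Literature.Geometry.Lorentzian.E4 x (K x) : TangentBundle (𝓡 4) 𝓑.carrier)) U → (∀ x ∈ U, ∀ v w : TangentSpace (𝓡 4) x, 𝓑.metric.val x (𝓑.metric.leviCivita K x v) w + 𝓑.metric.val x v (𝓑.metric.leviCivita K x w) = 0) → (∀ x ∈ U, VectorField.mlieBracket (𝓡 4) 𝓑.killing K x = 0) → (∀ p ∈ 𝓑.horizon, K p ≠ 0) → (∀ γ : ℝ → 𝓑.carrier, IsMIntegralCurve γ K → γ 0 ∈ 𝓑.horizon → ∀ t, γ t ∈ 𝓑.horizon) → (∀ x ∈ U ∩ 𝓑.doc, 𝓑.metric.val x (K x) (K x) < 0) → (∃ S₀ : Set 𝓑.carrier, IsCompact S₀ ∧ S₀ ⊆ 𝓑.doc ∧ ∀ y ∈ 𝓑.doc, 0 ≤ 𝓑.metric.val y (𝓑.killing y) (𝓑.killing y) → y ∉ U → y ∈ Literature.Geometry.Lorentzian.stationaryOrbit 𝓑.killing S₀) → ∀ S : Set 𝓑.carrier, IsCompact S → S ⊆ 𝓑.doc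 → ∀ (γ : ℝ → 𝓑.carrier) (s : Set ℝ), Literature.Geometry.Lorentzian.IsMaximalGeodesicOn 𝓑.metric.toPseudoRiemannianMetric.leviCivita γ s → s.Nonempty → (∀ t ∈ s, 𝓑.metric.val (γ t) (Literature.Geometry.Lorentzian.velocity (𝓡 4) γ t) (Literature.Geometry.Lorentzian.velocity (𝓡 4) γ t) = 0 ∧ Literature.Geometry.Lorentzian.velocity (𝓡 4) γ t ≠ 0 ∧ 𝓑.metric.val (γ t) (Literature.Geometry.Lorentzian.velocity (𝓡 4) γ t) (𝓑.killing (γ t)) = 0) → ∃ t ∈ s, γ t ∉ Literature.Geometry.Lorentzian.stationaryOrbit 𝓑.killing S := by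
  intro _ hZF 𝓑 _ h1 h2 h3 h4 h5 U K hU hHU hc hK hKill hbr hK0 htan htl hbelt S hS hSd γ s hγ hs hz
  by_contra hcon
  push Not at hcon
  obtain ⟨W, F, hW, hSW, hF, hinv, hpos⟩ :=
    hZF 𝓑 h1 h2 h3 h4 h5 U K hU hHU hc hK hKill hbr hK0 htan htl hbelt S hS hSd
  exact stub_escapeEngineFree 𝓑 S W F hS hW hSW hF hinv hpos γ s hγ hs hz hcon

end Summit.FinalStateConjecture.FinalStateConjecture.Theorems.ErgoregionBombModT

end
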